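import Mathlib.Analysis.Convex.Contractible
import Mathlib.AlgebraicTopology.FundamentalGroupoid.SimplyConnected
import Mathlib.Analysis.Complex.Convex
import Literature.Probability.LatticeModels.LatticeDobrushinBox
import HarnessLib

/-!
# Negative knowledge on crux `BoundaryTP2`, part 2: boxes are simply connected lattice domains

`siteDomain (boxSites a b)` (tree: `LatticeDobrushinDomain.lean`, `LatticeDobrushinBox.lean`) is the open
rectangle `(a₀-½, b₀+½) × (a₁-½, b₁+½)` (`siteDomain_boxSites`), hence convex and a `SimplyConnectedSpace`
(`simplyConnectedSpace_siteDomain_boxSites`).  With `LatticeDobrushin.ofBox` this realises every box of `ℤ²`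
as an admissible `Ω` of `BoundaryTP2` whose `Ω_1` is `ℤ²` induced on the box.  Everything proved. [folklore]
-/

namespace Summit.CriticalPhenomena.SAWScalingLimit.Theorems.BoundaryTP2.Negative

open Literature.Probability.LatticeModels

/-! ## §1 Boxes: `siteDomain (boxSites a b)` is an open rectangle, hence simply connected -/

section Box

variable {a b : Site 2}

/-- The open rectangle `(a₀-½, b₀+½) × (a₁-½, b₁+½)`. [folklore] -/
def openBox (a b : Site 2) : Set ℂ :=
  {z : ℂ | ((a 0 : ℝ) - 1 / 2 < z.re ∧ z.re < (b 0 : ℝ) + 1 / 2) ∧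
    ((a 1 : ℝ) - 1 / 2 < z.im ∧ z.im < (b 1 : ℝ) + 1 / 2)}

/-- **The site-square domain of a box of sites is the open rectangle around it.** [folklore] -/
theorem siteDomain_boxSites : siteDomain (boxSites a b) = openBox a b := by
  ext z
  rw [mem_siteDomain_iff]
  constructor
  · intro h
    -- two test points: the ceiling point bounds `z` from below, the floor point from above
    have hlo := h ![⌈z.re - 1 / 2⌉, ⌈z.im - 1 / 2⌉] (by
      refine Fin.forall_fin_two.2 ⟨?_, ?_⟩
      · simp only [coordC_zero, Matrix.cons_val_zero]
        rw [abs_le]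
        constructor
        · have := Int.ceil_lt_add_one (z.re - 1 / 2); linarith
        · have := Int.le_ceil (z.re - 1 / 2); linarith
      · simp only [coordC_one, Matrix.cons_val_one, Matrix.cons_val_zero]
        rw [abs_le]
        constructor
        · have := Int.ceil_lt_add_one (z.im - 1 / 2); linarith
        · have := Int.le_ceil (z.im - 1 / 2); linarith)
    have hhi := h ![⌊z.re + 1 / 2⌋, ⌊z.im + 1 / 2⌋] (by
      refine Fin.forall_fin_two.2 ⟨?_, ?_⟩
      · simp only [coordC_zero, Matrix.cons_val_zero]
        rw [abs_le]
        constructor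
        · have := Int.floor_le (z.re + 1 / 2); linarith
        · have := Int.lt_floor_add_one (z.re + 1 / 2); linarith
      · simp only [coordC_one, Matrix.cons_val_one, Matrix.cons_val_zero]
        rw [abs_le]
        constructor
        · have := Int.floor_le (z.im + 1 / 2); linarith
        · have := Int.lt_floor_add_one (z.im + 1 / 2); linarith)
    rw [mem_boxSites_iff, Fin.forall_fin_two] at hlo hhi
    simp only [Matrix.cons_val_zero, Matrix.cons_val_one] at hlo hhi
    obtain ⟨⟨h0, -⟩, h1, -⟩ := hlo
    obtain ⟨⟨-, h2⟩, -, h3⟩ := hhi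
    refine ⟨⟨?_, ?_⟩, ?_, ?_⟩
    · have hc : ((a 0 : ℤ) : ℝ) ≤ (⌈z.re - 1 / 2⌉ : ℝ) := by exact_mod_cast h0
      have := Int.ceil_lt_add_one (z.re - 1 / 2)
      linarith
    · have hc : ((⌊z.re + 1 / 2⌋ : ℤ) : ℝ) ≤ (b 0 : ℝ) := by exact_mod_cast h2
      have := Int.lt_floor_add_one (z.re + 1 / 2)
      linarith
    · have hc : ((a 1 : ℤ) : ℝ) ≤ (⌈z.im - 1 / 2⌉ : ℝ) := by exact_mod_cast h1
      have := Int.ceil_lt_add_one (z.im - 1 / 2)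
      linarith
    · have hc : ((⌊z.im + 1 / 2⌋ : ℤ) : ℝ) ≤ (b 1 : ℝ) := by exact_mod_cast h3
      have := Int.lt_floor_add_one (z.im + 1 / 2)
      linarith
  · rintro ⟨⟨hr1, hr2⟩, hi1, hi2⟩ x hx
    have hx0 := hx 0
    have hx1 := hx 1
    simp only [coordC_zero, coordC_one] at hx0 hx1
    rw [abs_le] at hx0 hx1
    rw [mem_boxSites_iff, Fin.forall_fin_two]
    refine ⟨⟨?_, ?_⟩, ?_, ?_⟩
    · have h' : ((a 0 : ℤ) : ℝ) - 1 < (x 0 : ℝ) := by linarith [hx0.1, hx0.2]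
      have h'' : (a 0 : ℤ) - 1 < x 0 := by exact_mod_cast h'
      omega
    · have h' : (x 0 : ℝ) < (b 0 : ℝ) + 1 := by linarith [hx0.1, hx0.2]
      have h'' : x 0 < b 0 + 1 := by exact_mod_cast h'
      omega
    · have h' : ((a 1 : ℤ) : ℝ) - 1 < (x 1 : ℝ) := by linarith [hx1.1, hx1.2]
      have h'' : (a 1 : ℤ) - 1 < x 1 := by exact_mod_cast h'
      omega
    · have h' : (x 1 : ℝ) < (b 1 : ℝ) + 1 := by linarith [hx1.1, hx1.2]
      have h'' : x 1 < b 1 + 1 := by exact_mod_cast h'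
      omega

/-- The open rectangle is convex. [folklore] -/
theorem convex_openBox (a b : Site 2) : Convex ℝ (openBox a b) := by
  have h : openBox a b = ({z : ℂ | (a 0 : ℝ) - 1 / 2 < z.re} ∩ {z : ℂ | z.re < (b 0 : ℝ) + 1 / 2}) ∩
      ({z : ℂ | (a 1 : ℝ) - 1 / 2 < z.im} ∩ {z : ℂ | z.im < (b 1 : ℝ) + 1 / 2}) := by
    ext z; simp only [openBox, Set.mem_inter_iff, Set.mem_setOf_eq]
  rw [h]
  exact ((convex_halfSpace_re_gt _).inter (convex_halfSpace_re_lt _)).inter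
    ((convex_halfSpace_im_gt _).inter (convex_halfSpace_im_lt _))

/-- The lattice point `a` lies in the open rectangle (`a ≤ b`). [folklore] -/
theorem toComplex_mem_openBox (hab : ∀ i, a i ≤ b i) : Site.toComplex a ∈ openBox a b := by
  have h0 : (a 0 : ℝ) ≤ b 0 := by exact_mod_cast hab 0
  have h1 : (a 1 : ℝ) ≤ b 1 := by exact_mod_cast hab 1
  simp only [openBox, Set.mem_setOf_eq, Site.toComplex_re, Site.toComplex_im]
  refine ⟨⟨by linarith, by linarith⟩, by linarith, by linarith⟩

/-- **Boxes are simply connected domains**: `siteDomain (boxSites a b)` is simply connected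
(`a ≤ b`). [folklore] -/
theorem simplyConnectedSpace_siteDomain_boxSites (hab : ∀ i, a i ≤ b i) :
    SimplyConnectedSpace (siteDomain (boxSites a b)) := by
  rw [siteDomain_boxSites]
  haveI := (convex_openBox a b).contractibleSpace ⟨Site.toComplex a, toComplex_mem_openBox hab⟩
  infer_instance

end Box


end Summit.CriticalPhenomena.SAWScalingLimit.Theorems.BoundaryTP2.Negative
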